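/-
Copyright (c) 2026 the pub-hodgecm-mathlib formalisation cell (harness21).  Prover seat hodgecm-mathlib-F0P2-p02 (g14): road «S3-ram» (LEAD F0P3a-plan (g13); owner
F0P3a-p06 (g15); (Cnt2′) chair F0P3a-p07 (g14) rulings (3)∕(5)), organ (z3)(c′) «L3-AGN» — the engine rows from an ABSTRACT NILPOTENCY TOKEN, PART 1; 2026-09-02.
Text = ★ `UnitaryLatticeTreeEngineRowsGenRamified` (F0P3a-p04 (g19), p847733) with the eigenframe binders `(A s hs1 hγA heD)` replaced by the token `hnil3`.
-/
import Literature.NumberTheory.Automorphic.UnitaryLatticeTreeEngineRowsGenRamified          -- ★ L3 PART 2 (F0P3a-p04 (g19)): `engineRowGen_odd` (literal-free) + PART 1 label calculus + ★ NO-TV + ★ hB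
import HarnessLib

/-!
# The lattice graph of a hermitian space — THE ENGINE'S LOCAL-LAW BINDERS FROM AN ABSTRACT NILPOTENCY TOKEN (literal-agnostic L3), PART 1: rows `hB hC hR hE`
# (Kottwitz 1986 §3; Rogawski 1990 §4.9; Bruhat–Tits 1972 §10)

Topic `NumberTheory/Automorphic`; namespace `Literature.NumberTheory.Automorphic.UnitaryLatticeTree`.  THEOREMS ONLY (no definition, no instance, no notation, no named fact,
no `sorry`); kernel lane `--supports stmt-HodgeConjecture-24833`.  Cell `pub/hodgecm-mathlib` (D-0151), crux H413; road «S3-ram» (Literature seeding, count-neutral); the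
(Cnt2′) type-(2) assembly of chair F0P3a-p07 (g14), organ **(z3)(c′) «L3-AGN»** (rulings (3) 02:14:32Z ∕ (5) 02:25:51Z; F0P3a-p04 (g19) first right of refusal honoured).

WHY THIS FILE.  ★ L3 `engineRows_of_rows` (F0P3a-p04 (g19), `UnitaryLatticeTreeEngineRows{Gen,OfRows}Ramified`) derives the six local-law binders `hB hC hR hE hO hP` of the
★ tree-induction engine from the ★ ROW files for a literal WITH A `K`-EIGENFRAME `γ = A·diag(s)·A⁻¹`; inspection shows the eigenframe enters ONLY through the residual
nilpotency token `hnil := lev₃_of_lev_of_eigenframe_of_le … v (d + 1 ≤ D) (LEV[v](ϖ^d)) : LEV₃[v](ϖ^(3d+1))` (seven call sites), every row body being otherwise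
literal-agnostic (★ ROW-C∕R∕E∕O∕P + `horient` + the label calculus `hdep hrk hcl`).  The type-(2) literals `ι(γ₂, u)` of the (Cnt2′) tube have NO `K`-eigenframe (`γ₂` is
rootless), but ★ ROW-N carries their token (`map_sub_one_pow_three_le_scaleLattice_of_charpoly_block_antidiagonal`, F0P3-p03).  THIS FILE restates p04's rows with the
eigenframe binders `(A s hs1 hγA heD)` replaced by ONE hypothesis
`hnil3 : ∀ w d, d + 1 ≤ D → LEV[w](ϖ^d) → LEV₃[w](ϖ^(3d+1))` — proofs VERBATIM otherwise (`have hnil := hnil3 v _ ‹d+1 ≤ D› ‹LEV›`).  PART 1 (this file): **`engineRowNil_B`**,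
**`engineRowNil_C`**, **`engineRowNil_R`**, **`engineRowNil_E`** (`hodd` is ★ `engineRowGen_odd`, already literal-free); PART 2 (`UnitaryLatticeTreeEngineRowsNilTokenOfRowsRamified`):
`engineRowNil_O`, `engineRowNil_P`, the head `engineRows_of_rows_of_nilToken` and its type-(2) instantiation `engineRows_of_rows_of_charpoly_block`.

HONEST LABEL: HC_CM is proved only modulo the 2 remaining named inputs (hLiu418 24832, h413 24833) until rung 0 closes; nothing printed is asserted here (bookkeeping over
★ rows); «S3-ram» has no books consequence.

## References
* [Kottwitz1986] R. E. Kottwitz, *Base change for unit elements of Hecke algebras*, Compositio Math. 60 (1986), §3.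
* [Rogawski1990] J. D. Rogawski, *Automorphic Representations of Unitary Groups in Three Variables*, Ann. of Math. Stud. 123 (1990), §4.9 pp. 54–56.
* [BruhatTits1972] F. Bruhat, J. Tits, *Groupes réductifs sur un corps local I*, Publ. Math. IHÉS 41 (1972), §10.
* [Serre1980Trees] J.-P. Serre, *Trees* (1980), Ch. II §1.1.
-/

set_option autoImplicit false

noncomputable section

open scoped Valued WithZero Matrix MatrixGroups
open Polynomial Classical

namespace Literature.NumberTheory.Automorphic.UnitaryLatticeTree

open Literature.NumberTheory.Automorphic Literature.NumberTheory.Automorphic.HermitianLattice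

variable {K : Type*} [Field K] [Valued K ℤᵐ⁰] {σ : K →+* K} {ϖ : K}

/-! ## §1 The rows `hB`, `hC`, `hR`, `hE` from the nilpotency token -/

/-- **`hB`: a fixed self-dual vertex `v ≠ r₀` of depth `0` (`dep v < D ≤ B`) has NO fixed grandchildren** (★ hB `fixedGrandchildren_eq_empty_of_levelZero`; its
token `¬LEV₂[v](ϖ)` by ★ NO-TV from `¬LEV[v](ϖ)`, its nilpotency token by `hnil3` at `d = 0`). [cite: Kottwitz1986, §3] [cite: BruhatTits1972, §10] -/
theorem engineRowNil_B (hσ : ∀ x, σ (σ x) = x) (hvσ : ∀ a, Valued.v (σ a) = Valued.v a) (hσϖ : σ ϖ = -ϖ)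
    (hϖ : Valued.v ϖ = WithZero.exp (-1 : ℤ)) (hres : ∀ x : K, Valued.v x ≤ 1 → Valued.v (σ x - x) < 1) (h2 : Valued.v (2 : K) = 1) [Finite 𝓀[K]]
    (hT : (latticeGraph σ ϖ ((StdForm.antidiagonal 3).over K)).IsTree)
    {γ : unitaryGroupOfForm σ ((StdForm.antidiagonal 3).over K)} (hγ0 : γ ∈ unitaryInt σ ((StdForm.antidiagonal 3).over K))
    {D : ℕ} (hnil3 : ∀ (w : {M : Submodule 𝒪[K] (Fin 3 → K) // IsVertex σ ϖ ((StdForm.antidiagonal 3).over K) M}) (d : ℕ), d + 1 ≤ D →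
      w.1.map ((Matrix.toLin' (((γ : GL (Fin 3) K) : Matrix (Fin 3) (Fin 3) K) - 1)).restrictScalars 𝒪[K]) ≤ scaleLattice (ϖ ^ d) w.1 →
      w.1.map ((Matrix.toLin' ((((γ : GL (Fin 3) K) : Matrix (Fin 3) (Fin 3) K) - 1) ^ 3)).restrictScalars 𝒪[K]) ≤ scaleLattice (ϖ ^ (3 * d + 1)) w.1)
    (B : ℕ) (dep : {M : Submodule 𝒪[K] (Fin 3 → K) // IsVertex σ ϖ ((StdForm.antidiagonal 3).over K) M} → ℕ)
    (hdep : ∀ w : {M : Submodule 𝒪[K] (Fin 3 → K) // IsVertex σ ϖ ((StdForm.antidiagonal 3).over K) M}, latticeGraphIso σ ϖ ((StdForm.antidiagonal 3).over K) γ w = w → ∀ e, e ≤ dep w ↔ e ≤ B ∧ w.1.map ((Matrix.toLin' (((γ : GL (Fin 3) K) : Matrix (Fin 3) (Fin 3) K) - 1)).restrictScalars 𝒪[K]) ≤ scaleLattice (ϖ ^ e) w.1)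
    (hBD : D ≤ B)
    (GC : {M : Submodule 𝒪[K] (Fin 3 → K) // IsVertex σ ϖ ((StdForm.antidiagonal 3).over K) M} → Set {M : Submodule 𝒪[K] (Fin 3 → K) // IsVertex σ ϖ ((StdForm.antidiagonal 3).over K) M}) (hGC : ∀ v w, w ∈ GC v ↔ ∃ c, ((latticeGraph σ ϖ ((StdForm.antidiagonal 3).over K)).Adj v c ∧ (latticeGraph σ ϖ ((StdForm.antidiagonal 3).over K)).dist ⟨stdLattice K 3, 0, isSelfDualLattice_stdLattice_three_of_v hϖ⟩ c = (latticeGraph σ ϖ ((StdForm.antidiagonal 3).over K)).dist ⟨stdLattice K 3, 0, isSelfDualLattice_stdLattice_three_of_v hϖ⟩ v + 1 ∧ c ∈ {v | latticeGraphIso σ ϖ ((StdForm.antidiagonal 3).over K) γ v = v}) ∧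
      ((latticeGraph σ ϖ ((StdForm.antidiagonal 3).over K)).Adj c w ∧ (latticeGraph σ ϖ ((StdForm.antidiagonal 3).over K)).dist ⟨stdLattice K 3, 0, isSelfDualLattice_stdLattice_three_of_v hϖ⟩ w = (latticeGraph σ ϖ ((StdForm.antidiagonal 3).over K)).dist ⟨stdLattice K 3, 0, isSelfDualLattice_stdLattice_three_of_v hϖ⟩ c + 1 ∧ w ∈ {v | latticeGraphIso σ ϖ ((StdForm.antidiagonal 3).over K) γ v = v}))
    (v : {M : Submodule 𝒪[K] (Fin 3 → K) // IsVertex σ ϖ ((StdForm.antidiagonal 3).over K) M}) (hvF : v ∈ {v : {M : Submodule 𝒪[K] (Fin 3 → K) // IsVertex σ ϖ ((StdForm.antidiagonal 3).over K) M} | latticeGraphIso σ ϖ ((StdForm.antidiagonal 3).over K) γ v = v}) (hv : IsSelfDualLattice σ ϖ ((StdForm.antidiagonal 3).over K) v.1) (hvr : v ≠ ⟨stdLattice K 3, 0, isSelfDualLattice_stdLattice_three_of_v hϖ⟩) (hvD : dep v < D) (hd0 : dep v = 0) :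
    GC v = ∅ := by
  have hfix : latticeGraphIso σ ϖ ((StdForm.antidiagonal 3).over K) γ v = v := hvF
  have hnot := not_lev_pow_of_dep_lt hdep hfix (show 1 ≤ B by omega) (by omega : dep v < 1)
  rw [pow_one] at hnot
  have hrk' := not_lev₂_of_not_lev_of_fixed_selfDual hσ hvσ hσϖ hϖ hres h2 hγ0 hv hfix hnot
  have hnil := hnil3 v _ (by omega : 0 + 1 ≤ D) (lev_pow_of_le_dep hdep hfix (Nat.zero_le _))
  rw [show 3 * 0 + 1 = 1 from rfl, pow_one] at hnil
  rw [gc_eq_rowSet hϖ GC hGC v]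
  exact fixedGrandchildren_eq_empty_of_levelZero hσ hvσ hσϖ hϖ h2 hT hγ0 hv hvr hfix hrk' hnil

/-- **`hC`: a fixed self-dual vertex of depth `1 < D` and rank `1` has no fixed grandchildren** (★ ROW-C). [cite: Kottwitz1986, §3] [cite: BruhatTits1972, §10] -/
theorem engineRowNil_C (hσ : ∀ x, σ (σ x) = x) (hvσ : ∀ a, Valued.v (σ a) = Valued.v a) (hσϖ : σ ϖ = -ϖ)
    (hϖ : Valued.v ϖ = WithZero.exp (-1 : ℤ)) (hres : ∀ x : K, Valued.v x ≤ 1 → Valued.v (σ x - x) < 1) (h2 : Valued.v (2 : K) = 1) [Finite 𝓀[K]]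
    (hT : (latticeGraph σ ϖ ((StdForm.antidiagonal 3).over K)).IsTree)
    {γ : unitaryGroupOfForm σ ((StdForm.antidiagonal 3).over K)} (hγ0 : γ ∈ unitaryInt σ ((StdForm.antidiagonal 3).over K))
    {D : ℕ} (hnil3 : ∀ (w : {M : Submodule 𝒪[K] (Fin 3 → K) // IsVertex σ ϖ ((StdForm.antidiagonal 3).over K) M}) (d : ℕ), d + 1 ≤ D →
      w.1.map ((Matrix.toLin' (((γ : GL (Fin 3) K) : Matrix (Fin 3) (Fin 3) K) - 1)).restrictScalars 𝒪[K]) ≤ scaleLattice (ϖ ^ d) w.1 →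
      w.1.map ((Matrix.toLin' ((((γ : GL (Fin 3) K) : Matrix (Fin 3) (Fin 3) K) - 1) ^ 3)).restrictScalars 𝒪[K]) ≤ scaleLattice (ϖ ^ (3 * d + 1)) w.1)
    (B : ℕ) (dep rk : {M : Submodule 𝒪[K] (Fin 3 → K) // IsVertex σ ϖ ((StdForm.antidiagonal 3).over K) M} → ℕ)
    (hdep : ∀ w : {M : Submodule 𝒪[K] (Fin 3 → K) // IsVertex σ ϖ ((StdForm.antidiagonal 3).over K) M}, latticeGraphIso σ ϖ ((StdForm.antidiagonal 3).over K) γ w = w → ∀ e, e ≤ dep w ↔ e ≤ B ∧ w.1.map ((Matrix.toLin' (((γ : GL (Fin 3) K) : Matrix (Fin 3) (Fin 3) K) - 1)).restrictScalars 𝒪[K]) ≤ scaleLattice (ϖ ^ e) w.1)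
    (hrk : ∀ w : {M : Submodule 𝒪[K] (Fin 3 → K) // IsVertex σ ϖ ((StdForm.antidiagonal 3).over K) M}, rk w = if w.1.map ((Matrix.toLin' ((((γ : GL (Fin 3) K) : Matrix (Fin 3) (Fin 3) K) - 1) ^ 2)).restrictScalars 𝒪[K]) ≤ scaleLattice (ϖ ^ (2 * dep w + 1)) w.1 then 1 else 2)
    (hBD : D ≤ B)
    (GC : {M : Submodule 𝒪[K] (Fin 3 → K) // IsVertex σ ϖ ((StdForm.antidiagonal 3).over K) M} → Set {M : Submodule 𝒪[K] (Fin 3 → K) // IsVertex σ ϖ ((StdForm.antidiagonal 3).over K) M}) (hGC : ∀ v w, w ∈ GC v ↔ ∃ c, ((latticeGraph σ ϖ ((StdForm.antidiagonal 3).over K)).Adj v c ∧ (latticeGraph σ ϖ ((StdForm.antidiagonal 3).over K)).dist ⟨stdLattice K 3, 0, isSelfDualLattice_stdLattice_three_of_v hϖ⟩ c = (latticeGraph σ ϖ ((StdForm.antidiagonal 3).over K)).dist ⟨stdLattice K 3, 0, isSelfDualLattice_stdLattice_three_of_v hϖ⟩ v + 1 ∧ c ∈ {v | latticeGraphIso σ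 ϖ ((StdForm.antidiagonal 3).over K) γ v = v}) ∧
      ((latticeGraph σ ϖ ((StdForm.antidiagonal 3).over K)).Adj c w ∧ (latticeGraph σ ϖ ((StdForm.antidiagonal 3).over K)).dist ⟨stdLattice K 3, 0, isSelfDualLattice_stdLattice_three_of_v hϖ⟩ w = (latticeGraph σ ϖ ((StdForm.antidiagonal 3).over K)).dist ⟨stdLattice K 3, 0, isSelfDualLattice_stdLattice_three_of_v hϖ⟩ c + 1 ∧ w ∈ {v | latticeGraphIso σ ϖ ((StdForm.antidiagonal 3).over K) γ v = v}))
    (horient : ∀ v : {M : Submodule 𝒪[K] (Fin 3 → K) // IsVertex σ ϖ ((StdForm.antidiagonal 3).over K) M}, IsSelfDualLattice σ ϖ ((StdForm.antidiagonal 3).over K) v.1 → v ≠ ⟨stdLattice K 3, 0, isSelfDualLattice_stdLattice_three_of_v hϖ⟩ → latticeGraphIso σ ϖ ((StdForm.antidiagonal 3).over K) γ v = v → dep v < D →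
      ∃ p g : {M : Submodule 𝒪[K] (Fin 3 → K) // IsVertex σ ϖ ((StdForm.antidiagonal 3).over K) M}, (latticeGraph σ ϖ ((StdForm.antidiagonal 3).over K)).Adj v p ∧ (latticeGraph σ ϖ ((StdForm.antidiagonal 3).over K)).dist ⟨stdLattice K 3, 0, isSelfDualLattice_stdLattice_three_of_v hϖ⟩ p + 1 = (latticeGraph σ ϖ ((StdForm.antidiagonal 3).over K)).dist ⟨stdLattice K 3, 0, isSelfDualLattice_stdLattice_three_of_v hϖ⟩ v ∧ (latticeGraph σ ϖ ((StdForm.antidiagonal 3).over K)).Adj p g ∧ g ≠ v ∧ g.1.map ((Matrix.toLin' (((γ : GL (Fin 3) K) : Matrix (Fin 3) (Fin 3) K) - 1)).restrictScalars 𝒪[K]) ≤ scaleLattice (ϖ ^ dep v) g.1)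
    (v : {M : Submodule 𝒪[K] (Fin 3 → K) // IsVertex σ ϖ ((StdForm.antidiagonal 3).over K) M}) (hvF : v ∈ {v : {M : Submodule 𝒪[K] (Fin 3 → K) // IsVertex σ ϖ ((StdForm.antidiagonal 3).over K) M} | latticeGraphIso σ ϖ ((StdForm.antidiagonal 3).over K) γ v = v}) (hv : IsSelfDualLattice σ ϖ ((StdForm.antidiagonal 3).over K) v.1) (hvr : v ≠ ⟨stdLattice K 3, 0, isSelfDualLattice_stdLattice_three_of_v hϖ⟩) (hvD : dep v < D) (hd1 : dep v = 1) (hrk1 : rk v = 1) :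
    GC v = ∅ := by
  have hfix : latticeGraphIso σ ϖ ((StdForm.antidiagonal 3).over K) γ v = v := hvF
  obtain ⟨p, g, hp, hpin, hg, hgv, hup⟩ := horient v hv hvr hfix hvD
  rw [hd1, pow_one] at hup
  have hlev := lev_pow_of_le_dep hdep hfix (le_of_eq hd1.symm)
  rw [pow_one] at hlev
  have hexact := not_lev_pow_of_dep_lt hdep hfix (show 2 ≤ B by omega) (by omega : dep v < 2)
  have hrk' := ((rk_eq_one_iff_of_hrk hrk v).1).1 hrk1
  rw [hd1] at hrk'
  have hnil := hnil3 v _ (by omega : 1 + 1 ≤ D) (by rw [pow_one]; exact hlev)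
  rw [gc_eq_rowSet hϖ GC hGC v]
  exact fixedGrandchildren_eq_empty_of_rankOne_depthOne hσ hvσ hσϖ hϖ hres h2 hT hγ0 hv hvr hfix hp hpin hg hgv hup hlev hexact hrk' hnil

/-- **`hR`: a REGULAR fixed self-dual vertex of depth `1 < D` has `q` fixed grandchildren, all of depth `0`** (★ ROW-R). [cite: Kottwitz1986, §3] [cite: BruhatTits1972, §10] -/
theorem engineRowNil_R (hσ : ∀ x, σ (σ x) = x) (hvσ : ∀ a, Valued.v (σ a) = Valued.v a) (hσϖ : σ ϖ = -ϖ)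
    (hϖ : Valued.v ϖ = WithZero.exp (-1 : ℤ)) (hres : ∀ x : K, Valued.v x ≤ 1 → Valued.v (σ x - x) < 1) (h2 : Valued.v (2 : K) = 1) [Finite 𝓀[K]]
    (hT : (latticeGraph σ ϖ ((StdForm.antidiagonal 3).over K)).IsTree)
    {γ : unitaryGroupOfForm σ ((StdForm.antidiagonal 3).over K)} (hγ0 : γ ∈ unitaryInt σ ((StdForm.antidiagonal 3).over K))
    {D : ℕ} (hnil3 : ∀ (w : {M : Submodule 𝒪[K] (Fin 3 → K) // IsVertex σ ϖ ((StdForm.antidiagonal 3).over K) M}) (d : ℕ), d + 1 ≤ D →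
      w.1.map ((Matrix.toLin' (((γ : GL (Fin 3) K) : Matrix (Fin 3) (Fin 3) K) - 1)).restrictScalars 𝒪[K]) ≤ scaleLattice (ϖ ^ d) w.1 →
      w.1.map ((Matrix.toLin' ((((γ : GL (Fin 3) K) : Matrix (Fin 3) (Fin 3) K) - 1) ^ 3)).restrictScalars 𝒪[K]) ≤ scaleLattice (ϖ ^ (3 * d + 1)) w.1)
    (B : ℕ) (dep rk : {M : Submodule 𝒪[K] (Fin 3 → K) // IsVertex σ ϖ ((StdForm.antidiagonal 3).over K) M} → ℕ)
    (hdep : ∀ w : {M : Submodule 𝒪[K] (Fin 3 → K) // IsVertex σ ϖ ((StdForm.antidiagonal 3).over K) M}, latticeGraphIso σ ϖ ((StdForm.antidiagonal 3).over K) γ w = w → ∀ e, e ≤ dep w ↔ e ≤ B ∧ w.1.map ((Matrix.toLin' (((γ : GL (Fin 3) K) : Matrix (Fin 3) (Fin 3) K) - 1)).restrictScalars 𝒪[K]) ≤ scaleLattice (ϖ ^ e) w.1)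
    (hrk : ∀ w : {M : Submodule 𝒪[K] (Fin 3 → K) // IsVertex σ ϖ ((StdForm.antidiagonal 3).over K) M}, rk w = if w.1.map ((Matrix.toLin' ((((γ : GL (Fin 3) K) : Matrix (Fin 3) (Fin 3) K) - 1) ^ 2)).restrictScalars 𝒪[K]) ≤ scaleLattice (ϖ ^ (2 * dep w + 1)) w.1 then 1 else 2)
    (hBD : D ≤ B)
    (GC : {M : Submodule 𝒪[K] (Fin 3 → K) // IsVertex σ ϖ ((StdForm.antidiagonal 3).over K) M} → Set {M : Submodule 𝒪[K] (Fin 3 → K) // IsVertex σ ϖ ((StdForm.antidiagonal 3).over K) M}) (hGC : ∀ v w, w ∈ GC v ↔ ∃ c, ((latticeGraph σ ϖ ((StdForm.antidiagonal 3).over K)).Adj v c ∧ (latticeGraph σ ϖ ((StdForm.antidiagonal 3).over K)).dist ⟨stdLattice K 3, 0, isSelfDualLattice_stdLattice_three_of_v hϖ⟩ c = (latticeGraph σ ϖ ((StdForm.antidiagonal 3).over K)).dist ⟨stdLattice K 3, 0, isSelfDualLattice_stdLattice_three_of_v hϖ⟩ v + 1 ∧ c ∈ {v | latticeGraphIso σ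 ϖ ((StdForm.antidiagonal 3).over K) γ v = v}) ∧
      ((latticeGraph σ ϖ ((StdForm.antidiagonal 3).over K)).Adj c w ∧ (latticeGraph σ ϖ ((StdForm.antidiagonal 3).over K)).dist ⟨stdLattice K 3, 0, isSelfDualLattice_stdLattice_three_of_v hϖ⟩ w = (latticeGraph σ ϖ ((StdForm.antidiagonal 3).over K)).dist ⟨stdLattice K 3, 0, isSelfDualLattice_stdLattice_three_of_v hϖ⟩ c + 1 ∧ w ∈ {v | latticeGraphIso σ ϖ ((StdForm.antidiagonal 3).over K) γ v = v}))
    (q : ℕ) (hq : q = Nat.card 𝓀[K])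
    (horient : ∀ v : {M : Submodule 𝒪[K] (Fin 3 → K) // IsVertex σ ϖ ((StdForm.antidiagonal 3).over K) M}, IsSelfDualLattice σ ϖ ((StdForm.antidiagonal 3).over K) v.1 → v ≠ ⟨stdLattice K 3, 0, isSelfDualLattice_stdLattice_three_of_v hϖ⟩ → latticeGraphIso σ ϖ ((StdForm.antidiagonal 3).over K) γ v = v → dep v < D →
      ∃ p g : {M : Submodule 𝒪[K] (Fin 3 → K) // IsVertex σ ϖ ((StdForm.antidiagonal 3).over K) M}, (latticeGraph σ ϖ ((StdForm.antidiagonal 3).over K)).Adj v p ∧ (latticeGraph σ ϖ ((StdForm.antidiagonal 3).over K)).dist ⟨stdLattice K 3, 0, isSelfDualLattice_stdLattice_three_of_v hϖ⟩ p + 1 = (latticeGraph σ ϖ ((StdForm.antidiagonal 3).over K)).dist ⟨stdLattice K 3, 0, isSelfDualLattice_stdLattice_three_of_v hϖ⟩ v ∧ (latticeGraph σ ϖ ((StdForm.antidiagonal 3).over K)).Adj p g ∧ g ≠ v ∧ g.1.map ((Matrix.toLin' (((γ : GL (Fin 3) K) : Matrix (Fin 3) (Fin 3) K) - 1)).restrictScalars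 𝒪[K]) ≤ scaleLattice (ϖ ^ dep v) g.1)
    (v : {M : Submodule 𝒪[K] (Fin 3 → K) // IsVertex σ ϖ ((StdForm.antidiagonal 3).over K) M}) (hvF : v ∈ {v : {M : Submodule 𝒪[K] (Fin 3 → K) // IsVertex σ ϖ ((StdForm.antidiagonal 3).over K) M} | latticeGraphIso σ ϖ ((StdForm.antidiagonal 3).over K) γ v = v}) (hv : IsSelfDualLattice σ ϖ ((StdForm.antidiagonal 3).over K) v.1) (hvr : v ≠ ⟨stdLattice K 3, 0, isSelfDualLattice_stdLattice_three_of_v hϖ⟩) (hvD : dep v < D) (hd1 : dep v = 1) (hrk2 : rk v = 2) :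
    (∀ w ∈ GC v, dep w = 0) ∧ (GC v).ncard = q := by
  have hfix : latticeGraphIso σ ϖ ((StdForm.antidiagonal 3).over K) γ v = v := hvF
  obtain ⟨p, g, hp, hpin, hg, hgv, hup⟩ := horient v hv hvr hfix hvD
  rw [hd1, pow_one] at hup
  have hlev := lev_pow_of_le_dep hdep hfix (le_of_eq hd1.symm)
  rw [pow_one] at hlev
  have hlev2 := not_lev_pow_of_dep_lt hdep hfix (show 2 ≤ B by omega) (by omega : dep v < 2)
  have hrk' := ((rk_eq_one_iff_of_hrk hrk v).2).1 hrk2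
  rw [hd1] at hrk'
  have hnil := hnil3 v _ (by omega : 1 + 1 ≤ D) (by rw [pow_one]; exact hlev)
  obtain ⟨hall, hcard⟩ := fixedGrandchildren_not_lev_and_ncard_of_regular_one hσ hvσ hσϖ hϖ hres h2 hT hγ0 hv hvr hfix hp hpin hg hgv hup hlev hlev2 hrk' hnil
  rw [gc_eq_rowSet hϖ GC hGC v, hq]
  refine ⟨fun w hw => ?_, hcard⟩
  have hwfix : latticeGraphIso σ ϖ ((StdForm.antidiagonal 3).over K) γ w = w := by obtain ⟨c, -, -, -, hwf⟩ := hw; exact hwf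
  have hn := hall w hw
  by_contra h0
  exact hn (by have := lev_pow_of_le_dep hdep hwfix (show 1 ≤ dep w by omega); rwa [pow_one] at this)

/-- **`hE`: an EVEN fixed self-dual vertex (depth `2m+2 < D`, rank `2`) has `q²` fixed grandchildren, all `(2m+1, rank 2)`** (★ ROW-E).
[cite: Kottwitz1986, §3] [cite: Rogawski1990, §4.9 pp. 54–56] -/
theorem engineRowNil_E (hσ : ∀ x, σ (σ x) = x) (hvσ : ∀ a, Valued.v (σ a) = Valued.v a) (hσϖ : σ ϖ = -ϖ)
    (hϖ : Valued.v ϖ = WithZero.exp (-1 : ℤ)) (hres : ∀ x : K, Valued.v x ≤ 1 → Valued.v (σ x - x) < 1) (h2 : Valued.v (2 : K) = 1) [Finite 𝓀[K]]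
    (hT : (latticeGraph σ ϖ ((StdForm.antidiagonal 3).over K)).IsTree)
    {γ : unitaryGroupOfForm σ ((StdForm.antidiagonal 3).over K)} (hγ0 : γ ∈ unitaryInt σ ((StdForm.antidiagonal 3).over K))
    {D : ℕ} (hnil3 : ∀ (w : {M : Submodule 𝒪[K] (Fin 3 → K) // IsVertex σ ϖ ((StdForm.antidiagonal 3).over K) M}) (d : ℕ), d + 1 ≤ D →
      w.1.map ((Matrix.toLin' (((γ : GL (Fin 3) K) : Matrix (Fin 3) (Fin 3) K) - 1)).restrictScalars 𝒪[K]) ≤ scaleLattice (ϖ ^ d) w.1 →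
      w.1.map ((Matrix.toLin' ((((γ : GL (Fin 3) K) : Matrix (Fin 3) (Fin 3) K) - 1) ^ 3)).restrictScalars 𝒪[K]) ≤ scaleLattice (ϖ ^ (3 * d + 1)) w.1)
    (B : ℕ) (dep rk : {M : Submodule 𝒪[K] (Fin 3 → K) // IsVertex σ ϖ ((StdForm.antidiagonal 3).over K) M} → ℕ)
    (hdep : ∀ w : {M : Submodule 𝒪[K] (Fin 3 → K) // IsVertex σ ϖ ((StdForm.antidiagonal 3).over K) M}, latticeGraphIso σ ϖ ((StdForm.antidiagonal 3).over K) γ w = w → ∀ e, e ≤ dep w ↔ e ≤ B ∧ w.1.map ((Matrix.toLin' (((γ : GL (Fin 3) K) : Matrix (Fin 3) (Fin 3) K) - 1)).restrictScalars 𝒪[K]) ≤ scaleLattice (ϖ ^ e) w.1)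
    (hrk : ∀ w : {M : Submodule 𝒪[K] (Fin 3 → K) // IsVertex σ ϖ ((StdForm.antidiagonal 3).over K) M}, rk w = if w.1.map ((Matrix.toLin' ((((γ : GL (Fin 3) K) : Matrix (Fin 3) (Fin 3) K) - 1) ^ 2)).restrictScalars 𝒪[K]) ≤ scaleLattice (ϖ ^ (2 * dep w + 1)) w.1 then 1 else 2)
    (hBD : D ≤ B)
    (GC : {M : Submodule 𝒪[K] (Fin 3 → K) // IsVertex σ ϖ ((StdForm.antidiagonal 3).over K) M} → Set {M : Submodule 𝒪[K] (Fin 3 → K) // IsVertex σ ϖ ((StdForm.antidiagonal 3).over K) M}) (hGC : ∀ v w, w ∈ GC v ↔ ∃ c, ((latticeGraph σ ϖ ((StdForm.antidiagonal 3).over K)).Adj v c ∧ (latticeGraph σ ϖ ((StdForm.antidiagonal 3).over K)).dist ⟨stdLattice K 3, 0, isSelfDualLattice_stdLattice_three_of_v hϖ⟩ c = (latticeGraph σ ϖ ((StdForm.antidiagonal 3).over K)).dist ⟨stdLattice K 3, 0, isSelfDualLattice_stdLattice_three_of_v hϖ⟩ v + 1 ∧ c ∈ {v | latticeGraphIso σ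 ϖ ((StdForm.antidiagonal 3).over K) γ v = v}) ∧
      ((latticeGraph σ ϖ ((StdForm.antidiagonal 3).over K)).Adj c w ∧ (latticeGraph σ ϖ ((StdForm.antidiagonal 3).over K)).dist ⟨stdLattice K 3, 0, isSelfDualLattice_stdLattice_three_of_v hϖ⟩ w = (latticeGraph σ ϖ ((StdForm.antidiagonal 3).over K)).dist ⟨stdLattice K 3, 0, isSelfDualLattice_stdLattice_three_of_v hϖ⟩ c + 1 ∧ w ∈ {v | latticeGraphIso σ ϖ ((StdForm.antidiagonal 3).over K) γ v = v}))
    (q : ℕ) (hq : q = Nat.card 𝓀[K])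
    (horient : ∀ v : {M : Submodule 𝒪[K] (Fin 3 → K) // IsVertex σ ϖ ((StdForm.antidiagonal 3).over K) M}, IsSelfDualLattice σ ϖ ((StdForm.antidiagonal 3).over K) v.1 → v ≠ ⟨stdLattice K 3, 0, isSelfDualLattice_stdLattice_three_of_v hϖ⟩ → latticeGraphIso σ ϖ ((StdForm.antidiagonal 3).over K) γ v = v → dep v < D →
      ∃ p g : {M : Submodule 𝒪[K] (Fin 3 → K) // IsVertex σ ϖ ((StdForm.antidiagonal 3).over K) M}, (latticeGraph σ ϖ ((StdForm.antidiagonal 3).over K)).Adj v p ∧ (latticeGraph σ ϖ ((StdForm.antidiagonal 3).over K)).dist ⟨stdLattice K 3, 0, isSelfDualLattice_stdLattice_three_of_v hϖ⟩ p + 1 = (latticeGraph σ ϖ ((StdForm.antidiagonal 3).over K)).dist ⟨stdLattice K 3, 0, isSelfDualLattice_stdLattice_three_of_v hϖ⟩ v ∧ (latticeGraph σ ϖ ((StdForm.antidiagonal 3).over K)).Adj p g ∧ g ≠ v ∧ g.1.map ((Matrix.toLin' (((γ : GL (Fin 3) K) : Matrix (Fin 3) (Fin 3) K) - 1)).restrictScalars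 𝒪[K]) ≤ scaleLattice (ϖ ^ dep v) g.1)
    (v : {M : Submodule 𝒪[K] (Fin 3 → K) // IsVertex σ ϖ ((StdForm.antidiagonal 3).over K) M}) (hvF : v ∈ {v : {M : Submodule 𝒪[K] (Fin 3 → K) // IsVertex σ ϖ ((StdForm.antidiagonal 3).over K) M} | latticeGraphIso σ ϖ ((StdForm.antidiagonal 3).over K) γ v = v}) (hv : IsSelfDualLattice σ ϖ ((StdForm.antidiagonal 3).over K) v.1) (hvr : v ≠ ⟨stdLattice K 3, 0, isSelfDualLattice_stdLattice_three_of_v hϖ⟩) (hvD : dep v < D) (m : ℕ) (hdm : dep v = 2 * m + 2) (hrk2 : rk v = 2) :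
    (∀ w ∈ GC v, dep w = 2 * m + 1 ∧ rk w = 2) ∧ (GC v).ncard = q ^ 2 := by
  have hfix : latticeGraphIso σ ϖ ((StdForm.antidiagonal 3).over K) γ v = v := hvF
  obtain ⟨p, g, hp, hpin, hg, hgv, hup⟩ := horient v hv hvr hfix hvD
  rw [hdm] at hup hvD
  have hlev := lev_pow_of_le_dep hdep hfix (le_of_eq hdm.symm)
  have hexact := not_lev_pow_of_dep_lt hdep hfix (show 2 * m + 2 + 1 ≤ B by omega) (by omega : dep v < 2 * m + 2 + 1)
  have hrk' := ((rk_eq_one_iff_of_hrk hrk v).2).1 hrk2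
  rw [hdm] at hrk'
  have hnil := hnil3 v _ (by omega : 2 * m + 2 + 1 ≤ D) hlev
  obtain ⟨hall, hcard⟩ := fixedGrandchildren_tokens_and_ncard_of_even hσ hvσ hσϖ hϖ hres h2 hT hγ0 hv hvr hfix (by omega : 2 ≤ 2 * m + 2) ⟨m + 1, by ring⟩
    hp hpin hg hgv hup hlev hexact hrk' hnil
  rw [gc_eq_rowSet hϖ GC hGC v, hq]
  refine ⟨fun w hw => ?_, hcard⟩
  have hwfix : latticeGraphIso σ ϖ ((StdForm.antidiagonal 3).over K) γ w = w := by obtain ⟨c, -, -, -, hwf⟩ := hw; exact hwf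
  obtain ⟨hw1, hw2, hw3⟩ := hall w hw
  rw [show 2 * m + 2 - 1 = 2 * m + 1 by omega] at hw1
  rw [show 2 * (2 * m + 2) - 1 = 2 * (2 * m + 1) + 1 by omega] at hw3
  have hdw : dep w = 2 * m + 1 := dep_eq_of_lev_of_not_lev hdep hwfix (by omega) hw1 hw2
  refine ⟨hdw, ((rk_eq_one_iff_of_hrk hrk w).2).2 ?_⟩
  rw [hdw]; exact hw3

end Literature.NumberTheory.Automorphic.UnitaryLatticeTree

end
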